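import Literature.MathematicalPhysics.QuantumFieldTheory.Balaban1983to89.B2Eq265AsPrinted
import Literature.MathematicalPhysics.QuantumFieldTheory.Balaban1983to89.B2Eq265TowerWitness
import Literature.MathematicalPhysics.QuantumFieldTheory.Balaban1983to89.B2Ineq2109HiggsLatticeTower

/-!
# `Balaban1983to89.B2Eq265AsPrintedWitness` — [Balaban1982Higgs2] Lemma 2.4 (2.65) p.572 in print's literal shape on the (Higgs)₂,₃
# carrier of record, print's own regions: THE HYPOTHESIS TELESCOPE OF THE END STATEMENT F22
# `B2Eq265AsPrinted.eq265_higgs_tower_asPrinted` IS JOINTLY SATISFIABLE AT PRINT'S READING `s := Lᵏε` — an explicit torus of the sub-family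
# `Shape` (`M = L^{Mmin}`), the (2.7)–(2.8)/(2.43) tower with no large-field points (`bad := ∅`, print's radii `r(Lⁱε)`), a cell box `□₂` of
# `⌊(2m+1)/M⌋ + 1` cells, the cube `□₁` of radius `R₁ = ⌈θ₂r(Lᵏε)⌉` about `x_k`, margin `m = max(R₁, ⌈θ₁r(Lᵏε)⌉, 2M(d+2)+3)`, the (2.44) cut-off
# `zeta244`, `R_n = 4`, `n = 2L`, zero charge datum / `A′ = 0` / `φ = 0`, a SMALL MESH `Lᵏε` (chosen after `M, e₁, t`) and a LARGE (2.55)₂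
# letter `μ₀` — every hypothesis of F22, including F18a's scale at `s := P.mesh (j+1)`, F19's printed restrictions (2.55), F20's two
# «e(ε) sufficiently small» conditions and F21's three dictionary hypotheses, discharged by the kernel at every step `j`
# (`tower_asPrinted_hypotheses_inhabited`), and F22 APPLIED to the witness (`eq265_higgs_tower_asPrinted_inhabited`)

statement-level skeleton of published theorems with citation tags; proofs where landed; nothing here is a claim
about the Yang–Mills mass gap

PDF held: `paper:balaban1982-cmp86-higgs23-ii` (journal page = PDF page + 554), p. 572 [PDF 18] (Lemma 2.4; «□₁, □₂ … distant from the
point y less than 2r(Lᵏε), 4r(Lᵏε)»), p. 570 [PDF 16] ((2.55)/(2.56)), p. 558 [PDF 4] ((2.7)–(2.8)), p. 557 [PDF 3] ((2.2), (2.5)), p. 566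
[PDF 12] ((2.43)/(2.44)); part I `paper:balaban1982-cmp85-higgs23-i` p. 604 [PDF 2] ((1.2) «ε⁻¹L_μ = L^K M L′_μ»).

CITATION HEADER (lean-in-tree rule).  T. Bałaban, *(Higgs)₂,₃ quantum fields in a finite volume. II. An upper bound*,
Commun. Math. Phys. **86** (1982) 555–594, doi:10.1007/bf01214890 [Balaban1982Higgs2].  Cell `lit-balaban` (HOME
`run/shared/lean/pub/lit-balaban/`), Phase-2 proof seat **p23** gen 25 (unit `lit-balaban-p23-g25`; free-target protocol G.5-34(d), TAKING #1
line HOME/STATUS.md 2026-08-23T16:53Z); SKELETON row **B2.Lem2.4** (fold owner r02, second reader r14; head `proved p250408 · p336252 ·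
p340291 · p341404` FINAL and UNCHANGED — cells-only NON-VACUITY WITNESS for the end statement F22, in the manner of own gen-23 F17
`B2Eq265TowerWitness` (the witness of F16) and own gen-20 `B2Lemma24ModelWitness`; it closes the carrier summary's open line «non-vacuity of
F21's telescope is NOT separately witnessed»).  USED BY NAME, never restated: own F22 `B2Eq265AsPrinted.eq265_higgs_tower_asPrinted` (§2), the
typer's carrier `HiggsLattice.Params`/`Site`/`sitesPerDir`, `B1Eq211ZeroFieldTorus.Shape`, `B2Eq255Concrete.{Restr255Printed, underRegion}`,
`B2Eq243RegionsTower.{towerRegion, towerRegion_eq_univ_of_no_bad}`, `B2Eq324NestedRegions.prime`, `B2Eq28RegionsConcrete.near`, p35's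
`B1Ineq225RegularBox.{cellBox, cellOf}`, `B1TorusCubeCover.half`, `B1TorusCubeLocality26.rS`, own gen-12 `B2Eq244Cutoff.{zeta244, …}`, p15's
`B2Ineq329ZeroAveraging.val_blockIter`, `B3MultiscaleFields.zeroCharge`, r14's `B2Lemma23HiggsLattice.cutMin`, `B3Ineq210RegularTorus.mesh_mono`,
p04's `B2Sect3AGaussianStep.one_add_log_inv_rpow_mul_rpow_le` (the logarithm of `p(·)` loses against a quarter power — F21a's device),
p14's `B1Ineq353Proof.pFn_nonneg`, r14's `B2LargeField.lambdaEps_pos`, b2b's `B2.rFn`/`B2.pFn`/`B2.Params.Printed`.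

WHY.  F22 `eq265_higgs_tower_asPrinted` — the END STATEMENT of the (2.65) lane (F5–F22) — carries some fifty hypotheses: F16's forty (torus
sub-family and sizes, the cell-box geometry of `□ = Bᵏ(□₂)`, the depth inequality, the cube `□₁` and its centre, the four (2.44) properties of
`ζ^{(k)}`, the (2.8) room condition) plus, since F18a–F21: the free physical scale `s ∈ (0, 1]` with the radii readings `θ₁r(s) ≤ m`,
`θ₂r(s) ≤ R₁ + 1`, the PRINTED restrictions (2.55) at the letter `ℓ′ = s/L` (F19), the two printed smallness conditions on the (2.60) size
`δ_A|e|` (F20; `δ_A` is no longer a free letter but the (2.55)₁,₂ thresholds themselves, so they do NOT hold trivially), and the three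
dictionary hypotheses `S ≤ θ₃r(s)`, `m²ℓ² ≤ m₁²s²`, `e_c ≤ ē·s^{(4−d)/2}` (F21).  F17 witnesses F16 only; an implication with unsatisfiable
hypotheses would be vacuous — this file certifies that F22's are jointly satisfiable, and records EXACTLY for which outer parameters.

WHAT THIS FILE PROVES (kernel-checked, zero `sorry`; theorems only — NO definition, NO `Prop`-valued fact; axioms standard).
 §0 `rFn_ge_of_le_exp` (`r(s) ≥ R(1 + c)` once `s ≤ e^{−c}`; `r(s) ≥ 0` is the landed `B2Ineq2109HiggsLatticeTower.rFn_nonneg_of_le_one`,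
 reused), **`smallness_inhabited`** (pure real analysis: for every
 `c₁ ≥ 0`, charge `e`, constants `C_V, C_F, δ, ρ₁`, `c_reg > 0`, `ē > 0`, `e₁, t > 0` there is `s₀ > 0` such that at every scale
 `0 < s ≤ min(s₀, 1)` some (2.55)₂ letter `μ₀ > 0` and some `0 < e_c ≤ min(e₁, ē·s^{(4−d)/2})` satisfy BOTH printed smallness conditions of
 F20/F22 with `Lᵏε = s` — the `C_V`-term is `O(s·p(s/L)) = O(s^{3/4})` by the quarter-power device, the `C_F`-term is `O(1/μ₀)`);
 §1 **`tower_asPrinted_hypotheses_inhabited`**: for all outer parameters of F22 with `ε₀ > 0`, `c_reg > 0`, `ē > 0`, `m² ≤ m₁²` and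
 `2·max(θ₁, θ₂) < θ₃`, all `δ, C_V, C_F`, all `Mmin`: `∃ M ≥ Mmin` (`M = L^{Mmin}`) such that for all `e₁, t > 0` and EVERY step `j` there
 are `P` (`Shape P`, `P.d = d`, `P.L = L`, `P.M = M`, `P.K = j + 1`), `bad`, `rad` (= print's radii), `□₂, □₁, S, q, Sbox, q₁, R₁, m, ζ, ρ, ρ₁,
 R_n, n, C₀, A′, μ₀, s` **with `s = P.mesh (j+1)`** (reading (P) of Q-p23g23-1), `e_c, x, φ` satisfying the hypothesis telescope of
 `eq265_higgs_tower_asPrinted` — the statement below IS that telescope with `∀/→` turned into `∃/∧`, binder for binder, in the same order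
 (deviations: `j` universal; the two recording conjuncts `rad = …`, `s = P.mesh (j+1)`);
 §2 **`eq265_higgs_tower_asPrinted_inhabited`**: F22 APPLIED to the witness — its bound `‖φ^{(k)}(x) − (Q_k^*(A^{(k)})φ)(x)‖ ≤ C·p(Lᵏε)` holds
 for the witness data at every `j` (the kernel's check that §1's telescope is F22's, binder for binder).

HONEST SCOPE (recorded, not hidden; one sentence each).  (a) A MODEL INSTANCE, DEGENERATE BY DESIGN in the analytic data, exactly as F17:
`bad := ∅` (all tower regions `= T^{(j)}`), ZERO fields `A′ = 0`, `φ = 0` and the zero charge datum on `ℝ^d` (so (2.55) holds because its four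
printed thresholds are `≥ 0`), cut-off support radius `ρ = 3`, plateau `ρ₁ = 0`; print's intended configuration (`□₁, □₂` about `y ∈ Λ₇′`,
non-zero fields) is NOT exercised — joint satisfiability is all a non-vacuity certificate needs.  (b) WHICH OUTER PARAMETERS (new w.r.t.
F17, and SHARP up to the boundary): the telescope is inhabited for ALL `d ≥ 1`, odd `L > 1`, `Q.Printed`, `c₁ ≥ 0`, `λ > 0`, every charge
datum `C` (any `e`), `θ₁, θ₂ > 0`, and `ε₀ > 0`, `c_reg > 0`, `ē > 0`, `m² ≤ m₁²`, `2·max(θ₁, θ₂) < θ₃`; conversely F22 IS vacuously true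
(correctly, as F16 at `ε₀ ≤ 0`) at `θ₃ ≤ 2θ₁` (the margin hypothesis forces `S ≥ 2m + 1 > 2θ₁r(s) `, against `S ≤ θ₃r(s)`), at `ē ≤ 0`
or `m₁ = 0` (`0 < e_c ≤ ē·s^{(4−d)/2}`, `m²(Lᵏε)² ≤ m₁²s²` with `m² > 0`), and at `c_reg = 0` whenever `c₁|e| > 0`; print's instance
`θ₁ = 4`, `θ₂ = 2` (p.572 «2r(Lᵏε), 4r(Lᵏε)»), `θ₃ = 8 + O(1)/R` (the side of `□₂` in units of `r`), `m₁ = m`, `ē = e > 0`, `c_reg = O(1) > 0`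
meets the conditions (note `θ₃ = 8` sharp would NOT: the certificate records that the `+O(1)/R` of the dictionary reading is needed).
(c) UNIFORMITY — ALL outer parameters, `δ, C_V, C_F, Mmin, e₁, t` and the step `j` are universal; CHOSEN: `M = L^{Mmin}`, the lattice `P` with
`P.K = j + 1`, `L′_μ = Lᵇ`, and the mesh `Lᵏε = s` SMALL as a function of `(M, e₁, t, θ's, c₁, e, C_V, c_reg, ē)` — `r(s) → ∞` pays for the
`M`-dependence of `□₂`'s side (`S ≤ 2·max(θ₁,θ₂)·r(s) + M(4d+9) + 9 ≤ θ₃r(s)`), `s·p(s/L) → 0` and `μ₀ → ∞` pay for the smallness conditions;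
`s ≤ 1` caps the scale as F22 does.  (d) Zero head weight; NOT summit progress; nothing minted (theorems only).
-/

open scoped BigOperators

noncomputable section

namespace Literature.MathematicalPhysics.QuantumFieldTheory.Balaban1983to89.B2Eq265AsPrintedWitness

open HiggsLattice (ChargeData)
open HiggsAveraging (blockIter toFinest)
open HiggsCovariance (avgQkAdj)
open B2Eq255Concrete (bgScalar256 Restr255 Restr255Printed underRegion mem_underRegion dA absA dPhi absPhi)
open B2Eq324NestedRegions (prime mem_prime)
open B2Eq243RegionsTower (towerRegion towerRegion_eq_univ_of_no_bad)
open B2Eq28RegionsConcrete (near subset_near)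
open B2Eq244Cutoff (zeta244 abs_zeta244_le_one zeta244_supp zeta244_eq_one zeta244_lip)
open B2Ineq329ZeroAveraging (val_blockIter)
open B2Lemma23HiggsLattice (cutMin)
open B1Eq211ZeroFieldTorus (Shape)
open B3MultiscaleFields (toSite ofSite zeroCharge)
open B1Ineq225RegularBox (cellBox mem_cellBox cellOf)
open B1TorusCubeCover (half)
open B1TorusCubeLocality26 (rS)

/-! ## §0 Real-analysis helpers: the radius `r(·)` grows without bound, the smallness conditions are satisfiable -/

/-- `r(s) = R(1 + log s⁻¹)^r ≥ R(1 + c)` as soon as `s ≤ e^{−c}` (`R > 0`, `r ≥ 1`, `c ≥ 0`): the (2.7) radius grows without bound as the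
scale goes to zero. [cite: Balaban1982Higgs2, (2.7) p.558] -/
theorem rFn_ge_of_le_exp {R r c s : ℝ} (hR : 0 < R) (hr : 1 ≤ r) (hc : 0 ≤ c) (hs : 0 < s) (hse : s ≤ Real.exp (-c)) :
    R * (1 + c) ≤ B2.rFn R r s := by
  have hexpc : Real.exp c ≤ s⁻¹ := by
    rw [le_inv_comm₀ (Real.exp_pos c) hs, ← Real.exp_neg]; exact hse
  have hlog : c ≤ Real.log s⁻¹ := (Real.le_log_iff_exp_le (inv_pos.mpr hs)).mpr hexpc
  have hbase : 1 ≤ 1 + Real.log s⁻¹ := by linarith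
  have hpow : 1 + Real.log s⁻¹ ≤ (1 + Real.log s⁻¹) ^ r := by
    have := Real.rpow_le_rpow_of_exponent_le hbase hr
    rwa [Real.rpow_one] at this
  unfold B2.rFn
  exact mul_le_mul_of_nonneg_left (by linarith) hR.le

/-- **THE TWO «e(ε) SUFFICIENTLY SMALL» CONDITIONS OF F20/F22 AND THE (2.5) READING `e_c ≤ ē·s^{(4−d)/2}` ARE JOINTLY SATISFIABLE AT EVERY
SMALL SCALE.**  For `L ≥ 1`, `b₀ ≥ 0`, `p > 0`, `c₁ ≥ 0`, `c_reg > 0`, `ē > 0`, `d ≥ 1`, any charge `e` and constants `C_V, C_F, δ, ρ₁`, and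
`e₁, t > 0`, there is `s₀ > 0` such that for every scale `0 < s ≤ s₀`, `s ≤ 1` some `μ₀ > 0` and some `0 < e_c ≤ min(e₁, ē·s^{(4−d)/2})` give
`(C_V·d·s·c₁p(s/L) + C_F e^{−δρ₁}·c₁p(s/L)/(μ₀·s/L))·|e| ≤ t` and `s·|e|·(the same) ≤ c_reg·e_c` — the `C_V`-term is `O(s^{3/4})` because
`p(s/L)·(s/L)^{1/4} ≤ b₀·max(1, 4p)^p` (`B2Sect3AGaussianStep.one_add_log_inv_rpow_mul_rpow_le`), the `C_F`-term is `O(1/μ₀)`.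
[cite: Balaban1982Higgs2, Lemma 2.4 proof p.572 «A^{(k)} − A₀ = O(p(Lᵏε)r(Lᵏε))», (2.2)/(2.5) p.557, (2.55) p.570] -/
theorem smallness_inhabited (L : ℕ) (hL : 1 ≤ L) {b₀ p : ℝ} (hb₀ : 0 ≤ b₀) (hp : 0 < p) {c₁ : ℝ} (hc₁ : 0 ≤ c₁)
    {creg ebar : ℝ} (hcreg : 0 < creg) (hebar : 0 < ebar) {d : ℕ} (hd : 1 ≤ d) (e CV CF δ ρ₁ : ℝ)
    {e₁ t : ℝ} (he₁ : 0 < e₁) (ht : 0 < t) :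
    ∃ s₀ : ℝ, 0 < s₀ ∧ ∀ s : ℝ, 0 < s → s ≤ s₀ → s ≤ 1 → ∃ μ₀ : ℝ, 0 < μ₀ ∧
      (CV * d * (s * (c₁ * B2.pFn b₀ p (s / L))) +
          CF * Real.exp (-(δ * ρ₁)) * (c₁ * (1 / (μ₀ * (s / L))) * B2.pFn b₀ p (s / L))) * |e| ≤ t ∧
      ∃ ec : ℝ, 0 < ec ∧ ec ≤ e₁ ∧ ec ≤ ebar * s ^ (((4 : ℝ) - d) / 2) ∧
        s * |e| * (CV * d * (s * (c₁ * B2.pFn b₀ p (s / L))) +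
          CF * Real.exp (-(δ * ρ₁)) * (c₁ * (1 / (μ₀ * (s / L))) * B2.pFn b₀ p (s / L))) ≤ creg * ec := by
  have hLR : (1 : ℝ) ≤ L := by exact_mod_cast hL
  have hL0 : (0 : ℝ) < L := lt_of_lt_of_le one_pos hLR
  -- constants: the quarter-power constant `Kp`, `A₁`, the threshold `cs` on `s^{1/4}`
  obtain ⟨Kp, hKp_def⟩ : ∃ Kp : ℝ, Kp = (max 1 (p / (4 : ℝ)⁻¹)) ^ p := ⟨_, rfl⟩
  have hKp0 : 0 ≤ Kp := by rw [hKp_def]; exact Real.rpow_nonneg (le_trans zero_le_one (le_max_left _ _)) _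
  obtain ⟨A₁, hA₁_def⟩ : ∃ A₁ : ℝ, A₁ = c₁ * |CV| * d * |e| * (L * b₀ * Kp) := ⟨_, rfl⟩
  have hA₁0 : 0 ≤ A₁ := by rw [hA₁_def]; positivity
  have hA₁1 : 0 < A₁ + 1 := by linarith
  have hfrac : A₁ / (A₁ + 1) ≤ 1 := div_le_one_of_le₀ (by linarith) hA₁1.le
  obtain ⟨cs, hcs_def⟩ : ∃ cs : ℝ,
      cs = min (t / (2 * (A₁ + 1))) (min (creg * e₁ / (2 * (A₁ + 1))) (creg * ebar / (2 * (A₁ + 1)))) := ⟨_, rfl⟩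
  have hcs0 : 0 < cs := by rw [hcs_def]; exact lt_min (by positivity) (lt_min (by positivity) (by positivity))
  have hcs_t : cs ≤ t / (2 * (A₁ + 1)) := by rw [hcs_def]; exact min_le_left _ _
  have hcs_e : cs ≤ creg * e₁ / (2 * (A₁ + 1)) := by rw [hcs_def]; exact (min_le_right _ _).trans (min_le_left _ _)
  have hcs_b : cs ≤ creg * ebar / (2 * (A₁ + 1)) := by rw [hcs_def]; exact (min_le_right _ _).trans (min_le_right _ _)
  obtain ⟨cm, hcm_def⟩ : ∃ cm : ℝ, cm = min 1 cs := ⟨_, rfl⟩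
  have hcm0 : 0 < cm := by rw [hcm_def]; exact lt_min one_pos hcs0
  have hcmcs : cm ≤ cs := by rw [hcm_def]; exact min_le_right _ _
  refine ⟨cm ^ 4, pow_pos hcm0 4, fun s hs hscm hs1 => ?_⟩
  -- the (2.55) letter `ℓ = s/L` and `p(ℓ)`
  obtain ⟨ℓ, hℓ_def⟩ : ∃ ℓ : ℝ, ℓ = s / L := ⟨_, rfl⟩
  have hℓ0 : 0 < ℓ := by rw [hℓ_def]; exact div_pos hs hL0
  have hℓs : ℓ ≤ s := by rw [hℓ_def]; exact div_le_self hs.le hLR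
  have hℓ1 : ℓ ≤ 1 := hℓs.trans hs1
  have hℓne : ℓ ≠ 0 := hℓ0.ne'
  have hsL : s = L * ℓ := by rw [hℓ_def]; field_simp
  obtain ⟨pf, hpf_def⟩ : ∃ pf : ℝ, pf = B2.pFn b₀ p ℓ := ⟨_, rfl⟩
  have hpf0 : 0 ≤ pf := by rw [hpf_def]; exact B1Ineq353Proof.pFn_nonneg hb₀ hℓ0 hℓ1
  rw [← hℓ_def, ← hpf_def]
  -- the logarithm loses against a quarter power: `p(ℓ)·ℓ^{1/4} ≤ b₀·Kp`, hence `s·p(ℓ) ≤ L·b₀·Kp·ℓ^{3/4}`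
  have hKp : (1 + Real.log ℓ⁻¹) ^ p * ℓ ^ (4 : ℝ)⁻¹ ≤ Kp := by
    rw [hKp_def]; exact B2Sect3AGaussianStep.one_add_log_inv_rpow_mul_rpow_le hp (by norm_num) hℓ0 hℓ1
  have hpfq : pf * ℓ ^ (4 : ℝ)⁻¹ ≤ b₀ * Kp := by
    rw [hpf_def]; unfold B2.pFn
    rw [mul_assoc]
    exact mul_le_mul_of_nonneg_left hKp hb₀
  have h34 : 0 ≤ ℓ ^ (3 * (4 : ℝ)⁻¹) := Real.rpow_nonneg hℓ0.le _
  have hsplit : ℓ ^ (3 * (4 : ℝ)⁻¹) * ℓ ^ (4 : ℝ)⁻¹ = ℓ := by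
    rw [← Real.rpow_add hℓ0]; norm_num
  have hspf : s * pf ≤ L * b₀ * Kp * ℓ ^ (3 * (4 : ℝ)⁻¹) := by
    calc s * pf = L * (ℓ ^ (3 * (4 : ℝ)⁻¹) * (pf * ℓ ^ (4 : ℝ)⁻¹)) := by
          rw [hsL]
          conv_lhs => rw [← hsplit]
          ring
      _ ≤ L * (ℓ ^ (3 * (4 : ℝ)⁻¹) * (b₀ * Kp)) :=
          mul_le_mul_of_nonneg_left (mul_le_mul_of_nonneg_left hpfq h34) hL0.le
      _ = L * b₀ * Kp * ℓ ^ (3 * (4 : ℝ)⁻¹) := by ring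
  -- `s^{1/4} ≤ cm ≤ cs`, `ℓ^{3/4} ≤ ℓ^{1/4} ≤ s^{1/4}`
  have hsq : s ^ (4 : ℝ)⁻¹ ≤ cm := by
    have h1 : s ^ (4 : ℝ)⁻¹ ≤ (cm ^ 4) ^ (4 : ℝ)⁻¹ := Real.rpow_le_rpow hs.le hscm (by norm_num)
    have h2 : (cm ^ 4) ^ (4 : ℝ)⁻¹ = cm := by
      have := Real.pow_rpow_inv_natCast hcm0.le (n := 4) (by norm_num)
      simpa using this
    rw [h2] at h1
    exact h1
  have hsqcs : s ^ (4 : ℝ)⁻¹ ≤ cs := hsq.trans hcmcs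
  have hℓ3s : ℓ ^ (3 * (4 : ℝ)⁻¹) ≤ s ^ (4 : ℝ)⁻¹ :=
    calc ℓ ^ (3 * (4 : ℝ)⁻¹) ≤ ℓ ^ (4 : ℝ)⁻¹ := Real.rpow_le_rpow_of_exponent_ge hℓ0 hℓ1 (by norm_num)
      _ ≤ s ^ (4 : ℝ)⁻¹ := Real.rpow_le_rpow hℓ0.le hℓs (by norm_num)
  have hℓq : ℓ ^ (3 * (4 : ℝ)⁻¹) ≤ cs := hℓ3s.trans hsqcs
  -- TERM 1 (the `C_V` part): `C_V·d·s·c₁p(ℓ)·|e| ≤ A₁·ℓ^{3/4}`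
  have hX0 : 0 ≤ s * (c₁ * pf) := by positivity
  have hT1 : CV * d * (s * (c₁ * pf)) * |e| ≤ A₁ * ℓ ^ (3 * (4 : ℝ)⁻¹) := by
    calc CV * d * (s * (c₁ * pf)) * |e| ≤ |CV| * d * (s * (c₁ * pf)) * |e| :=
          mul_le_mul_of_nonneg_right (mul_le_mul_of_nonneg_right
            (mul_le_mul_of_nonneg_right (le_abs_self CV) (Nat.cast_nonneg d)) hX0) (abs_nonneg e)
      _ = c₁ * |CV| * d * |e| * (s * pf) := by ring
      _ ≤ c₁ * |CV| * d * |e| * (L * b₀ * Kp * ℓ ^ (3 * (4 : ℝ)⁻¹)) :=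
          mul_le_mul_of_nonneg_left hspf (by positivity)
      _ = A₁ * ℓ ^ (3 * (4 : ℝ)⁻¹) := by rw [hA₁_def]; ring
  have hT1t : CV * d * (s * (c₁ * pf)) * |e| ≤ t / 2 := by
    calc CV * d * (s * (c₁ * pf)) * |e| ≤ A₁ * ℓ ^ (3 * (4 : ℝ)⁻¹) := hT1
      _ ≤ A₁ * (t / (2 * (A₁ + 1))) := mul_le_mul_of_nonneg_left (hℓq.trans hcs_t) hA₁0
      _ = A₁ / (A₁ + 1) * (t / 2) := by field_simp
      _ ≤ 1 * (t / 2) := mul_le_mul_of_nonneg_right hfrac (by positivity)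
      _ = t / 2 := one_mul _
  -- TERM 1 inside the second condition: `2·s·(A₁ℓ^{3/4}) ≤ c_reg·e₁` and `≤ c_reg·ē·s^{(4−d)/2}`
  have hsd : 0 < s ^ (((4 : ℝ) - d) / 2) := Real.rpow_pos_of_pos hs _
  have hT1e : 2 * (s * (CV * d * (s * (c₁ * pf)) * |e|)) ≤ creg * e₁ := by
    have h1 : s * (CV * d * (s * (c₁ * pf)) * |e|) ≤ A₁ * ℓ ^ (3 * (4 : ℝ)⁻¹) :=
      (mul_le_mul_of_nonneg_left hT1 hs.le).trans (mul_le_of_le_one_left (mul_nonneg hA₁0 h34) hs1)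
    have h2 : A₁ * ℓ ^ (3 * (4 : ℝ)⁻¹) ≤ A₁ * (creg * e₁ / (2 * (A₁ + 1))) :=
      mul_le_mul_of_nonneg_left (hℓq.trans hcs_e) hA₁0
    have h3 : 2 * (A₁ * (creg * e₁ / (2 * (A₁ + 1)))) = A₁ / (A₁ + 1) * (creg * e₁) := by field_simp
    have h4 : A₁ / (A₁ + 1) * (creg * e₁) ≤ 1 * (creg * e₁) := mul_le_mul_of_nonneg_right hfrac (by positivity)
    linarith
  have hT1b : 2 * (s * (CV * d * (s * (c₁ * pf)) * |e|)) ≤ creg * (ebar * s ^ (((4 : ℝ) - d) / 2)) := by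
    -- `s·ℓ^{3/4} ≤ s·s^{3/4} = s^{3/2}·s^{1/4} ≤ s^{(4−d)/2}·s^{1/4}`
    have hℓ3 : ℓ ^ (3 * (4 : ℝ)⁻¹) ≤ s ^ (3 * (4 : ℝ)⁻¹) := Real.rpow_le_rpow hℓ0.le hℓs (by norm_num)
    have hss : s * s ^ (3 * (4 : ℝ)⁻¹) = s ^ ((3 : ℝ) / 2) * s ^ (4 : ℝ)⁻¹ := by
      calc s * s ^ (3 * (4 : ℝ)⁻¹) = s ^ (1 : ℝ) * s ^ (3 * (4 : ℝ)⁻¹) := by rw [Real.rpow_one]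
        _ = s ^ ((1 : ℝ) + 3 * (4 : ℝ)⁻¹) := (Real.rpow_add hs _ _).symm
        _ = s ^ ((3 : ℝ) / 2 + (4 : ℝ)⁻¹) := by norm_num
        _ = s ^ ((3 : ℝ) / 2) * s ^ (4 : ℝ)⁻¹ := Real.rpow_add hs _ _
    have hd' : ((4 : ℝ) - d) / 2 ≤ (3 : ℝ) / 2 := by
      have : (1 : ℝ) ≤ d := by exact_mod_cast hd
      linarith
    have h32 : s ^ ((3 : ℝ) / 2) ≤ s ^ (((4 : ℝ) - d) / 2) := Real.rpow_le_rpow_of_exponent_ge hs hs1 hd'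
    have h1 : s * (CV * d * (s * (c₁ * pf)) * |e|) ≤ A₁ * (s ^ (((4 : ℝ) - d) / 2) * cs) :=
      calc s * (CV * d * (s * (c₁ * pf)) * |e|) ≤ s * (A₁ * ℓ ^ (3 * (4 : ℝ)⁻¹)) := mul_le_mul_of_nonneg_left hT1 hs.le
        _ ≤ s * (A₁ * s ^ (3 * (4 : ℝ)⁻¹)) := mul_le_mul_of_nonneg_left (mul_le_mul_of_nonneg_left hℓ3 hA₁0) hs.le
        _ = A₁ * (s ^ ((3 : ℝ) / 2) * s ^ (4 : ℝ)⁻¹) := by rw [← hss]; ring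
        _ ≤ A₁ * (s ^ (((4 : ℝ) - d) / 2) * cs) :=
            mul_le_mul_of_nonneg_left (mul_le_mul h32 hsqcs (Real.rpow_nonneg hs.le _) hsd.le) hA₁0
    have h2 : A₁ * (s ^ (((4 : ℝ) - d) / 2) * cs) ≤ A₁ * (s ^ (((4 : ℝ) - d) / 2) * (creg * ebar / (2 * (A₁ + 1)))) :=
      mul_le_mul_of_nonneg_left (mul_le_mul_of_nonneg_left hcs_b hsd.le) hA₁0
    have h3 : 2 * (A₁ * (s ^ (((4 : ℝ) - d) / 2) * (creg * ebar / (2 * (A₁ + 1)))))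
        = A₁ / (A₁ + 1) * (creg * (ebar * s ^ (((4 : ℝ) - d) / 2))) := by field_simp
    have h4 : A₁ / (A₁ + 1) * (creg * (ebar * s ^ (((4 : ℝ) - d) / 2))) ≤ 1 * (creg * (ebar * s ^ (((4 : ℝ) - d) / 2))) :=
      mul_le_mul_of_nonneg_right hfrac (by positivity)
    linarith
  -- the charge size `e_c := min(e₁, ē·s^{(4−d)/2})`
  obtain ⟨ec, hec_def⟩ : ∃ ec : ℝ, ec = min e₁ (ebar * s ^ (((4 : ℝ) - d) / 2)) := ⟨_, rfl⟩
  have hec0 : 0 < ec := by rw [hec_def]; exact lt_min he₁ (mul_pos hebar hsd)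
  have hece₁ : ec ≤ e₁ := by rw [hec_def]; exact min_le_left _ _
  have hecs : ec ≤ ebar * s ^ (((4 : ℝ) - d) / 2) := by rw [hec_def]; exact min_le_right _ _
  have hT1c : 2 * (s * (CV * d * (s * (c₁ * pf)) * |e|)) ≤ creg * ec := by
    rw [hec_def]
    rcases min_choice e₁ (ebar * s ^ (((4 : ℝ) - d) / 2)) with h | h <;> rw [h]
    · exact hT1e
    · exact hT1b
  -- TERM 2 (the `C_F` part) and THE CHOICE OF `μ₀`
  obtain ⟨Y, hY_def⟩ : ∃ Y : ℝ, Y = Real.exp (-(δ * ρ₁)) * (c₁ * pf) / ℓ := ⟨_, rfl⟩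
  have hY0 : 0 ≤ Y := by rw [hY_def]; exact div_nonneg (mul_nonneg (Real.exp_pos _).le (mul_nonneg hc₁ hpf0)) hℓ0.le
  obtain ⟨E, hE_def⟩ : ∃ E : ℝ, E = |CF| * Y * |e| := ⟨_, rfl⟩
  have hE0 : 0 ≤ E := by rw [hE_def]; positivity
  have hEfrac : E / (E + 1) ≤ 1 := div_le_one_of_le₀ (by linarith) (by linarith)
  obtain ⟨D, hD_def⟩ : ∃ D : ℝ, D = 2 / t + 2 * s / (creg * ec) := ⟨_, rfl⟩
  have hDt : 2 / t ≤ D := by rw [hD_def]; exact le_add_of_nonneg_right (by positivity)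
  have hDc : 2 * s / (creg * ec) ≤ D := by rw [hD_def]; exact le_add_of_nonneg_left (by positivity)
  have hD0 : 0 < D := lt_of_lt_of_le (by positivity) hDt
  obtain ⟨μ₀, hμ₀_def⟩ : ∃ μ₀ : ℝ, μ₀ = (E + 1) * D := ⟨_, rfl⟩
  have hμ₀ : 0 < μ₀ := by rw [hμ₀_def]; exact mul_pos (by linarith) hD0
  have hμ₀ne : μ₀ ≠ 0 := hμ₀.ne'
  have hX2 : CF * Real.exp (-(δ * ρ₁)) * (c₁ * (1 / (μ₀ * ℓ)) * pf) * |e| ≤ 1 / D := by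
    have heq : CF * Real.exp (-(δ * ρ₁)) * (c₁ * (1 / (μ₀ * ℓ)) * pf) * |e| = CF * Y * |e| / μ₀ := by
      rw [hY_def]; field_simp
    have hle : CF * Y * |e| ≤ E := by
      rw [hE_def]
      exact mul_le_mul_of_nonneg_right (mul_le_mul_of_nonneg_right (le_abs_self CF) hY0) (abs_nonneg e)
    calc CF * Real.exp (-(δ * ρ₁)) * (c₁ * (1 / (μ₀ * ℓ)) * pf) * |e| = CF * Y * |e| / μ₀ := heq
      _ ≤ E / μ₀ := div_le_div_of_nonneg_right hle hμ₀.le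
      _ = E / (E + 1) / D := by rw [hμ₀_def, div_div]
      _ ≤ 1 / D := div_le_div_of_nonneg_right hEfrac hD0.le
  have hX2t : CF * Real.exp (-(δ * ρ₁)) * (c₁ * (1 / (μ₀ * ℓ)) * pf) * |e| ≤ t / 2 := by
    calc _ ≤ 1 / D := hX2
      _ ≤ 1 / (2 / t) := one_div_le_one_div_of_le (by positivity) hDt
      _ = t / 2 := one_div_div 2 t
  have hX2c : 2 * (s * (CF * Real.exp (-(δ * ρ₁)) * (c₁ * (1 / (μ₀ * ℓ)) * pf) * |e|)) ≤ creg * ec := by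
    have h1 : s * (CF * Real.exp (-(δ * ρ₁)) * (c₁ * (1 / (μ₀ * ℓ)) * pf) * |e|) ≤ s * (1 / (2 * s / (creg * ec))) :=
      mul_le_mul_of_nonneg_left (hX2.trans (one_div_le_one_div_of_le (by positivity) hDc)) hs.le
    have h2 : s * (1 / (2 * s / (creg * ec))) = creg * ec / 2 := by
      field_simp
    linarith
  refine ⟨μ₀, hμ₀, ?_, ec, hec0, hece₁, hecs, ?_⟩
  · -- `(C_V-term + C_F-term)·|e| ≤ t/2 + t/2`
    rw [add_mul]
    linarith
  · -- `s·|e|·(C_V-term + C_F-term) ≤ c_reg·e_c/2 + c_reg·e_c/2`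
    have : s * |e| * (CV * d * (s * (c₁ * pf)) + CF * Real.exp (-(δ * ρ₁)) * (c₁ * (1 / (μ₀ * ℓ)) * pf))
        = s * (CV * d * (s * (c₁ * pf)) * |e|) + s * (CF * Real.exp (-(δ * ρ₁)) * (c₁ * (1 / (μ₀ * ℓ)) * pf) * |e|) := by
      ring
    rw [this]
    linarith

/-! ## §1 The hypothesis telescope of `eq265_higgs_tower_asPrinted` is inhabited -/

set_option maxHeartbeats 400000 in -- a sixty-binder telescope: the elaboration of §1 needs ≈ 1.5× the default budget
/-- **NON-VACUITY OF THE END STATEMENT OF LEMMA 2.4'S VALUE CLAUSE (2.65) IN PRINT'S SHAPE.**  The hypothesis telescope of own F22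
`B2Eq265AsPrinted.eq265_higgs_tower_asPrinted` with `∀/→` turned into `∃/∧`, binder for binder and in the same order (only `j` made universal;
two recording conjuncts `rad = print's radii`, `s = P.mesh (j+1)` added), is inhabited: for all outer parameters with `ε₀ > 0`, `c_reg > 0`,
`ē > 0`, `m² ≤ m₁²`, `2·max(θ₁, θ₂) < θ₃`, all `δ, C_V, C_F`, all `Mmin` there is `M ≥ Mmin` such that for all `e₁, t > 0` and every step `j`
an explicit torus of the sub-family with `P.M = M`, the no-large-field tower (`bad := ∅`) with print's radii `r(Lⁱε)`, a cell box `□₂ ⊇` the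
margin-`m` neighbourhood of `x_k` with `S ≤ θ₃r(Lᵏε)`, the cube `□₁` of radius `R₁` centred at `x_k`, the (2.44) cut-off `zeta244`, `R_n = 4`,
`n = 2L`, the zero charge datum, `A′ = 0`, a (2.55)₂ letter `μ₀`, THE SCALE `s = Lᵏε` (small), a charge size `e_c`, and `φ = 0` satisfy every
hypothesis — in particular the PRINTED restrictions (2.55) at `ℓ′ = Lᵏε/L` and the two printed smallness conditions on the (2.60) size.
[cite: Balaban1982Higgs2, Lemma 2.4 (2.65) p.572] [cite: Balaban1982Higgs2, (2.55)–(2.56) p.570, (2.7)–(2.8) p.558, (2.43)–(2.44) p.566, (2.2)/(2.5) p.557]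
[cite: Balaban1982Higgs1, (1.2) p.604] -/
theorem tower_asPrinted_hypotheses_inhabited (d L : ℕ) (hd : 1 ≤ d) (hL : Odd L ∧ 1 < L)
    (aV mu0sq : ℝ) (N : ℕ) (C : ChargeData N) {ε₀ : ℝ} (hε₀ : 0 < ε₀) {creg : ℝ} (hcreg : 0 < creg)
    (Q : B2.Params) (hQ : Q.Printed) {c₁ lam : ℝ} (hc₁ : 0 ≤ c₁) (hlam : 0 < lam)
    {θ₁ θ₂ θ₃ : ℝ} (hθ₁ : 0 < θ₁) (hθ₂ : 0 < θ₂) (hθ₃ : 2 * max θ₁ θ₂ < θ₃)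
    {ebar m₁ msq : ℝ} (hebar : 0 < ebar) (hm₁ : msq ≤ m₁ ^ 2)
    (δ CV CF : ℝ) (Mmin : ℕ) :
    ∃ M : ℕ, Mmin ≤ M ∧ ∀ (e₁ t : ℝ), 0 < e₁ → 0 < t → ∀ (j : ℕ),
      ∃ (P : HiggsLattice.Params) (_ : Shape P), P.d = d ∧ P.L = L ∧ P.M = M ∧
      j + 1 ≤ P.K ∧ (∀ μ, 3 * half P (j + 1) M ≤ P.sitesPerDir 0 μ) ∧ P.mesh (j + 1) ≤ ε₀ ∧ P.mesh (j + 1) ≤ 1 ∧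
      ∃ (bad : (l : ℕ) → Set (HiggsLattice.Site P l)) (rad : ℕ → ℝ),
        (rad = fun i => B2.rFn Q.R Q.r (P.mesh i)) ∧ 0 < rad j ∧
      ∃ (sq₂ sq₁ : Finset (HiggsLattice.Site P (j + 1))) (S : Fin P.d → Finset ℕ) (q : HiggsLattice.Site P (j + 1)) (Sbox : ℕ),
        sq₂ ⊆ prime (towerRegion bad rad j 2) ∧
        sq₁ ⊆ prime (towerRegion bad rad j 6) ∧
        underRegion (j + 1) sq₂ = cellBox (j + 1) M S ∧
        (∀ μ : Fin P.d, P.L ^ (j + 1) * Sbox < P.sitesPerDir 0 μ) ∧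
        (∀ y : HiggsLattice.Site P (j + 1), y ∈ sq₂ ↔ ∀ ν : Fin P.d, (y ν - q ν).val < Sbox) ∧
        (∀ μ : Fin P.d, 2 * (P.L ^ (j + 1) * Sbox) ≤ P.sitesPerDir 0 μ) ∧
      ∃ (q₁ : HiggsLattice.Site P (j + 1)) (R₁ m : ℕ), R₁ ≤ m ∧
        2 * rS P (j + 1) M + 2 * half P (j + 1) M * (P.d + 1) + 1 ≤ P.L ^ (j + 1) * m ∧
        (∀ y : HiggsLattice.Site P (j + 1), y ∈ sq₁ ↔ ∀ ν : Fin P.d, (y ν - q₁ ν).val < 2 * R₁ + 1) ∧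
      ∃ (ζ : HiggsLattice.Site P 0 → HiggsLattice.Site P (j + 1) → ℝ) (ρ ρ₁ : ℝ), 0 ≤ ρ₁ ∧
        (∀ x y', |ζ x y'| ≤ 1) ∧
        (∀ x y', ζ x y' ≠ 0 → (HiggsLattice.Site.tdist (blockIter (j + 1) x) y' : ℝ) ≤ ρ) ∧
        (∀ x y', (HiggsLattice.Site.tdist (blockIter (j + 1) x) y' : ℝ) ≤ ρ₁ → ζ x y' = 1) ∧
        (∀ (x : HiggsLattice.Site P 0) (ν : Fin P.d) (y' : HiggsLattice.Site P (j + 1)), |ζ (x.shift ν) y' - ζ x y'| ≤ ((P.L : ℝ) ^ (j + 1))⁻¹) ∧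
      ∃ (Rn : ℕ), ρ + 1 ≤ (Rn : ℝ) ∧ (∀ μ : Fin P.d, 2 * (2 * Rn + 1) ≤ P.sitesPerDir (j + 1) μ) ∧
      ∃ (n : ℕ), (n : ℝ) < rad j ∧ (P.L : ℝ) * ((Rn : ℝ) + 1) - 1 ≤ 3 * (n : ℝ) ∧
      ∃ (C₀ : ChargeData P.d) (A' : HiggsLattice.VecField P (j + 1)) (μ₀ : ℝ), 0 < μ₀ ∧
      ∃ (s : ℝ), s = P.mesh (j + 1) ∧ 0 < s ∧ s ≤ 1 ∧
        θ₁ * B2.rFn Q.R Q.r s ≤ (m : ℝ) ∧ θ₂ * B2.rFn Q.R Q.r s ≤ (R₁ : ℝ) + 1 ∧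
        (Sbox : ℝ) ≤ θ₃ * B2.rFn Q.R Q.r s ∧ msq * P.mesh (j + 1) ^ 2 ≤ m₁ ^ 2 * s ^ 2 ∧
        (CV * P.d * (P.mesh (j + 1) * (c₁ * B2.pFn Q.b₀ Q.p (s / (L : ℝ)))) +
            CF * Real.exp (-(δ * ρ₁)) * (c₁ * (1 / (μ₀ * (s / (L : ℝ)))) * B2.pFn Q.b₀ Q.p (s / (L : ℝ)))) * |C.e| ≤ t ∧
      ∃ (ec : ℝ), 0 < ec ∧ ec ≤ e₁ ∧ ec ≤ ebar * s ^ (((4 : ℝ) - d) / 2) ∧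
        P.mesh (j + 1) * |C.e| * (CV * P.d * (P.mesh (j + 1) * (c₁ * B2.pFn Q.b₀ Q.p (s / (L : ℝ)))) +
            CF * Real.exp (-(δ * ρ₁)) * (c₁ * (1 / (μ₀ * (s / (L : ℝ)))) * B2.pFn Q.b₀ Q.p (s / (L : ℝ)))) ≤ creg * ec ∧
      ∃ (x : HiggsLattice.Site P 0),
        (∀ ν : Fin P.d, m ≤ ((blockIter (j + 1) x) ν - q ν).val ∧ ((blockIter (j + 1) x) ν - q ν).val + m < Sbox) ∧
        (∀ ν : Fin P.d, ((blockIter (j + 1) x) ν - q₁ ν).val = R₁) ∧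
      ∃ (φ : HiggsLattice.ScalarField P (j + 1) N),
        Restr255Printed C c₁ Q.b₀ Q.p μ₀ lam (s / (L : ℝ)) (j + 1)
          (prime (near (towerRegion bad rad j 0) (rad j))) A' φ
          (ofSite (cutMin C₀ mu0sq aV (j + 1) ζ (toSite A'))) := by
  -- the printed ranges: `R > 0`, `r > 1`, `p > 2`, `b₀ > 0`, `L > 1` odd
  have hR : 0 < Q.R := hQ.2.2.2.2.2.2.2
  have hr1 : 1 < Q.r := hQ.2.1
  have hp0 : 0 < Q.p := lt_trans two_pos hQ.1
  have hb0 : 0 < Q.b₀ := hQ.2.2.2.2.2.2.1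
  have hL1 : 1 < L := hL.2
  have hL0 : 0 < L := lt_trans Nat.zero_lt_one hL1
  have hLR : (1 : ℝ) < L := by exact_mod_cast hL1
  have hLR0 : (0 : ℝ) < L := lt_trans one_pos hLR
  -- `M = L^{Mmin} > Mmin`
  have hM1 : 1 ≤ L ^ Mmin := Nat.one_le_pow _ _ hL0
  refine ⟨L ^ Mmin, (Nat.lt_pow_self hL1 : Mmin < L ^ Mmin).le, ?_⟩
  intro e₁ t he₁ ht j
  -- THE CONSTANTS FIXED BEFORE THE MESH: `θm = max(θ₁,θ₂)`, the gap `θ₃ − 2θm`, the required radius `ρ* ≥ (M(4d+9) + 2L + 9)/min(gap,1)`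
  obtain ⟨θm, hθm_def⟩ : ∃ θm : ℝ, θm = max θ₁ θ₂ := ⟨_, rfl⟩
  have hθ₁m : θ₁ ≤ θm := by rw [hθm_def]; exact le_max_left _ _
  have hθ₂m : θ₂ ≤ θm := by rw [hθm_def]; exact le_max_right _ _
  have hθm0 : 0 < θm := lt_of_lt_of_le hθ₁ hθ₁m
  obtain ⟨gap, hgap_def⟩ : ∃ gap : ℝ, gap = θ₃ - 2 * θm := ⟨_, rfl⟩
  have hgap : 0 < gap := by rw [hgap_def, hθm_def]; linarith
  obtain ⟨gap', hgap'_def⟩ : ∃ gap' : ℝ, gap' = min gap 1 := ⟨_, rfl⟩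
  have hgap'0 : 0 < gap' := by rw [hgap'_def]; exact lt_min hgap one_pos
  have hgap'1 : gap' ≤ 1 := by rw [hgap'_def]; exact min_le_right _ _
  have hgap'g : gap' ≤ gap := by rw [hgap'_def]; exact min_le_left _ _
  obtain ⟨Rreq, hRreq_def⟩ : ∃ Rreq : ℝ, Rreq = ((L ^ Mmin * (4 * d + 9) + 2 * L + 9 : ℕ) : ℝ) := ⟨_, rfl⟩
  have hRreq_eq : Rreq = (L : ℝ) ^ Mmin * (4 * d + 9) + 2 * L + 9 := by rw [hRreq_def]; push_cast; ring
  have hRreq0 : 0 ≤ Rreq := by rw [hRreq_def]; exact Nat.cast_nonneg _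
  have hRreq2L : 2 * (L : ℝ) + 9 ≤ Rreq := by
    have : (0 : ℝ) ≤ (L : ℝ) ^ Mmin * (4 * d + 9) := by positivity
    rw [hRreq_eq]; linarith
  obtain ⟨ρs, hρs_def⟩ : ∃ ρs : ℝ, ρs = Rreq / gap' := ⟨_, rfl⟩
  have hρs0 : 0 ≤ ρs := by rw [hρs_def]; exact div_nonneg hRreq0 hgap'0.le
  have hρsR : Rreq ≤ ρs := by
    rw [hρs_def, le_div_iff₀ hgap'0]
    exact mul_le_of_le_one_right hRreq0 hgap'1
  have hρsgap : Rreq ≤ gap * ρs := by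
    have : gap' * ρs = Rreq := by rw [hρs_def]; field_simp
    calc Rreq = gap' * ρs := this.symm
      _ ≤ gap * ρs := mul_le_mul_of_nonneg_right hgap'g hρs0
  obtain ⟨c, hc_def⟩ : ∃ c : ℝ, c = ρs / Q.R := ⟨_, rfl⟩
  have hc0 : 0 ≤ c := by rw [hc_def]; exact div_nonneg hρs0 hR.le
  have hRc : Q.R * (1 + c) = Q.R + ρs := by rw [hc_def]; field_simp
  -- the smallness threshold `s₀` of §0 (depends on `e₁, t` and the outer data only)
  obtain ⟨s₀, hs₀, hsmall⟩ := smallness_inhabited L hL1.le hb0.le hp0 hc₁ hcreg hebar hd C.e CV CF δ 0 he₁ ht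
  -- THE MESH AT LEVEL `k = j + 1`: `s = min(ε₀, 1, e^{−c}, s₀)`
  obtain ⟨s, hs_def⟩ : ∃ s : ℝ, s = min (min ε₀ 1) (min (Real.exp (-c)) s₀) := ⟨_, rfl⟩
  have hs0 : 0 < s := by rw [hs_def]; exact lt_min (lt_min hε₀ one_pos) (lt_min (Real.exp_pos _) hs₀)
  have hsε₀ : s ≤ ε₀ := by rw [hs_def]; exact (min_le_left _ _).trans (min_le_left _ _)
  have hs1 : s ≤ 1 := by rw [hs_def]; exact (min_le_left _ _).trans (min_le_right _ _)
  have hsexp : s ≤ Real.exp (-c) := by rw [hs_def]; exact (min_le_right _ _).trans (min_le_left _ _)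
  have hss₀ : s ≤ s₀ := by rw [hs_def]; exact (min_le_right _ _).trans (min_le_right _ _)
  have hLk0 : 0 < L ^ (j + 1) := pow_pos hL0 _
  have hLk1 : 1 ≤ L ^ (j + 1) := Nat.one_le_pow _ _ hL0
  have hLk : (0 : ℝ) < (L : ℝ) ^ (j + 1) := pow_pos (by exact_mod_cast hL0) _
  obtain ⟨ε, hε_def⟩ : ∃ ε : ℝ, ε = s / (L : ℝ) ^ (j + 1) := ⟨_, rfl⟩
  have hε : 0 < ε := by rw [hε_def]; exact div_pos hs0 hLk
  -- the radius at level `k`, the cube `□₁` of radius `R₁`, the margin `m`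
  obtain ⟨rk, hrk_def⟩ : ∃ rk : ℝ, rk = B2.rFn Q.R Q.r s := ⟨_, rfl⟩
  have hrk0 : 0 ≤ rk := by rw [hrk_def]; exact B2Ineq2109HiggsLatticeTower.rFn_nonneg_of_le_one hR.le hs0 hs1
  have hrkc : Q.R * (1 + c) ≤ rk := by rw [hrk_def]; exact rFn_ge_of_le_exp hR hr1.le hc0 hs0 hsexp
  have hρsrk : ρs ≤ rk := by linarith
  obtain ⟨R₁, hR₁_def⟩ : ∃ R₁ : ℕ, R₁ = ⌈θ₂ * rk⌉₊ := ⟨_, rfl⟩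
  obtain ⟨m, hm_def⟩ : ∃ m : ℕ, m = max (max R₁ ⌈θ₁ * rk⌉₊) (2 * L ^ Mmin * (d + 2) + 3) := ⟨_, rfl⟩
  have hR₁m : R₁ ≤ m := by rw [hm_def]; exact (le_max_left _ _).trans (le_max_left _ _)
  have hmθ₁ : ⌈θ₁ * rk⌉₊ ≤ m := by rw [hm_def]; exact (le_max_right _ _).trans (le_max_left _ _)
  have hm₀ : 2 * L ^ Mmin * (d + 2) + 3 ≤ m := by rw [hm_def]; exact le_max_right _ _
  -- the real size of `m`: `m ≤ θm·rk + 1 + (2M(d+2) + 3)`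
  have hm_real : (m : ℝ) ≤ θm * rk + 1 + (2 * (L : ℝ) ^ Mmin * (d + 2) + 3) := by
    have hmN : m ≤ max R₁ ⌈θ₁ * rk⌉₊ + (2 * L ^ Mmin * (d + 2) + 3) := by
      rw [hm_def]; exact max_le (Nat.le_add_right _ _) (Nat.le_add_left _ _)
    have h1 : (R₁ : ℝ) ≤ θm * rk + 1 := by
      have := Nat.ceil_lt_add_one (mul_nonneg hθ₂.le hrk0)
      have h' : θ₂ * rk ≤ θm * rk := mul_le_mul_of_nonneg_right hθ₂m hrk0
      rw [hR₁_def]; linarith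
    have h2 : (⌈θ₁ * rk⌉₊ : ℝ) ≤ θm * rk + 1 := by
      have := Nat.ceil_lt_add_one (mul_nonneg hθ₁.le hrk0)
      have h' : θ₁ * rk ≤ θm * rk := mul_le_mul_of_nonneg_right hθ₁m hrk0
      linarith
    have h3 : ((max R₁ ⌈θ₁ * rk⌉₊ : ℕ) : ℝ) ≤ θm * rk + 1 := by
      rw [Nat.cast_max]; exact max_le h1 h2
    have h4 : (m : ℝ) ≤ ((max R₁ ⌈θ₁ * rk⌉₊ : ℕ) : ℝ) + ((2 * L ^ Mmin * (d + 2) + 3 : ℕ) : ℝ) := by exact_mod_cast hmN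
    have h5 : ((2 * L ^ Mmin * (d + 2) + 3 : ℕ) : ℝ) = 2 * (L : ℝ) ^ Mmin * (d + 2) + 3 := by push_cast; ring
    linarith
  -- the cell box `□₂`: `cnum = ⌊(2m+1)/M⌋ + 1` cells of `M` coarse sites, `Sbox = M·cnum ∈ (2m+1, 2m+1+M]`
  obtain ⟨cnum, hcnum_def⟩ : ∃ cnum : ℕ, cnum = (2 * m + 1) / L ^ Mmin + 1 := ⟨_, rfl⟩
  obtain ⟨Sbox, hSbox_def⟩ : ∃ Sbox : ℕ, Sbox = L ^ Mmin * cnum := ⟨_, rfl⟩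
  have hcnum_le : cnum ≤ 2 * m + 2 := by
    have : (2 * m + 1) / L ^ Mmin ≤ 2 * m + 1 := Nat.div_le_self _ _
    omega
  have hSbox_le : Sbox ≤ 2 * m + 1 + L ^ Mmin := by
    have : L ^ Mmin * ((2 * m + 1) / L ^ Mmin) ≤ 2 * m + 1 := Nat.mul_div_le _ _
    have h' : Sbox = L ^ Mmin * ((2 * m + 1) / L ^ Mmin) + L ^ Mmin := by rw [hSbox_def, hcnum_def]; ring
    omega
  have hSbox_gt : 2 * m + 1 < Sbox := by
    have h1 := Nat.lt_div_mul_add (a := 2 * m + 1) hM1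
    have h' : Sbox = (2 * m + 1) / L ^ Mmin * L ^ Mmin + L ^ Mmin := by rw [hSbox_def, hcnum_def]; ring
    rw [h']; exact h1
  obtain ⟨b, hb_def⟩ : ∃ b : ℕ, b = 2 * m + 10 := ⟨_, rfl⟩
  have hbpow : b < L ^ b := Nat.lt_pow_self hL1
  have hLb9 : 9 ≤ L ^ b := by omega
  have hcnumb : cnum < L ^ b := by omega
  have hcnumb' : cnum ≤ L ^ b := hcnumb.le
  -- THE TORUS (I.1.2) with `K = j + 1`, `M = L^{Mmin}`, `L′_μ = Lᵇ` in every direction (so `M·L′_μ = L^{Mmin+b}`: the sub-family `Shape`)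
  set P : HiggsLattice.Params :=
    { d := d, ε := ε, K := j + 1, L := L, M := L ^ Mmin, Lp := fun _ => L ^ b, hd := hd, hε := hε, hL := hL0,
      hM := pow_pos hL0 Mmin, hLp := fun _ => pow_pos hL0 b } with hP_def
  have S : Shape P := ⟨Mmin + b, hL, fun _ => (pow_add L Mmin b).symm⟩
  have hPd : P.d = d := rfl
  have hPL : P.L = L := rfl
  have hPM : P.M = L ^ Mmin := rfl
  have hsitesk : ∀ μ : Fin P.d, P.sitesPerDir (j + 1) μ = 2 * (L ^ Mmin * L ^ b) := by
    intro μ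
    show 2 * (L ^ (j + 1 - (j + 1)) * L ^ Mmin * L ^ b) = _
    rw [Nat.sub_self, pow_zero, one_mul]
  have hsites0 : ∀ μ : Fin P.d, P.sitesPerDir 0 μ = 2 * (L ^ (j + 1) * L ^ Mmin * L ^ b) := fun μ => rfl
  have hmeshk : P.mesh (j + 1) = s := by
    show (L : ℝ) ^ (j + 1) * ε = s
    rw [hε_def]; field_simp
  have hkK : j + 1 ≤ P.K := le_rfl
  have hhalf : half P (j + 1) (L ^ Mmin) = L ^ (j + 1) * L ^ Mmin := rfl
  refine ⟨P, S, rfl, rfl, rfl, le_rfl, ?_, hmeshk ▸ hsε₀, hmeshk ▸ hs1, ?_⟩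
  · -- `3·half ≤ |T_ε|`: `3 Lᵏ M ≤ 2 Lᵏ M Lᵇ`
    intro μ
    rw [hsites0, hhalf]
    calc 3 * (L ^ (j + 1) * L ^ Mmin) ≤ (2 * L ^ b) * (L ^ (j + 1) * L ^ Mmin) :=
          Nat.mul_le_mul_right _ (by omega)
      _ = 2 * (L ^ (j + 1) * L ^ Mmin * L ^ b) := by ring
  -- THE TOWER WITHOUT LARGE FIELDS (print's radii `r(Lⁱε)`), THE BOXES
  obtain ⟨rad, hrad_def⟩ : ∃ rad : ℕ → ℝ, rad = fun i => B2.rFn Q.R Q.r (P.mesh i) := ⟨_, rfl⟩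
  set bad : (l : ℕ) → Set (HiggsLattice.Site P l) := fun _ => ∅ with hbad_def
  have htower : ∀ i, towerRegion bad rad j i = Finset.univ := towerRegion_eq_univ_of_no_bad (fun _ => rfl) j
  have hprime : ∀ i, prime (towerRegion bad rad j i) = (Finset.univ : Finset (HiggsLattice.Site P (j + 1))) := by
    intro i
    rw [htower i]
    exact Finset.eq_univ_iff_forall.mpr fun y => (mem_prime _ y).mpr fun x _ => Finset.mem_univ x
  -- `r(Lʲε) ≥ R + ρ* > 2L` (the (2.8) room condition) since `Lʲε ≤ Lᵏε = s ≤ e^{−c}`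
  have hmj : P.mesh j ≤ s := hmeshk ▸ B3Ineq210RegularTorus.mesh_mono P (Nat.le_succ j)
  have hmj0 : 0 < P.mesh j := P.mesh_pos j
  have hrj : Q.R * (1 + c) ≤ rad j := by
    rw [hrad_def]
    exact rFn_ge_of_le_exp hR hr1.le hc0 hmj0 (hmj.trans hsexp)
  have hradj : 2 * (L : ℝ) < rad j := by linarith
  have hrad0 : 0 < rad j := lt_trans (by positivity) hradj
  set q : HiggsLattice.Site P (j + 1) := fun _ => 0 with hq_def
  set sq₂ : Finset (HiggsLattice.Site P (j + 1)) :=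
    Finset.univ.filter fun y => ∀ ν : Fin P.d, (y ν - q ν).val < Sbox with hsq₂_def
  set Sfin : Fin P.d → Finset ℕ := fun _ => Finset.range cnum with hSfin_def
  set q₁ : HiggsLattice.Site P (j + 1) := fun ν => ((m - R₁ : ℕ) : ZMod (P.sitesPerDir (j + 1) ν)) with hq₁_def
  set sq₁ : Finset (HiggsLattice.Site P (j + 1)) :=
    Finset.univ.filter fun y => ∀ ν : Fin P.d, (y ν - q₁ ν).val < 2 * R₁ + 1 with hsq₁_def
  have hmem₂ : ∀ y : HiggsLattice.Site P (j + 1), y ∈ sq₂ ↔ ∀ ν : Fin P.d, (y ν - q ν).val < Sbox := by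
    intro y; simp [hsq₂_def]
  have hmem₁ : ∀ y : HiggsLattice.Site P (j + 1), y ∈ sq₁ ↔ ∀ ν : Fin P.d, (y ν - q₁ ν).val < 2 * R₁ + 1 := by
    intro y; simp [hsq₁_def]
  have hq0 : ∀ ν : Fin P.d, q ν = 0 := fun ν => rfl
  refine ⟨bad, rad, hrad_def, hrad0, sq₂, sq₁, Sfin, q, Sbox, by rw [hprime]; exact Finset.subset_univ _,
    by rw [hprime]; exact Finset.subset_univ _, ?_, ?_, hmem₂, ?_, q₁, R₁, m, hR₁m, ?_, hmem₁, ?_⟩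
  · -- `Bᵏ(□₂) = cellBox`: `⌊x_ν/Lᵏ⌋ < M·cnum ↔ ⌊x_ν/(LᵏM)⌋ < cnum`
    ext x
    rw [mem_underRegion, hmem₂, mem_cellBox]
    refine forall_congr' fun ν => ?_
    rw [hq0, sub_zero, val_blockIter hkK]
    show (x ν).val / L ^ (j + 1) < Sbox ↔ (x ν).val / (L ^ (j + 1) * L ^ Mmin) ∈ Finset.range cnum
    rw [Finset.mem_range, Nat.div_lt_iff_lt_mul hLk0, Nat.div_lt_iff_lt_mul (Nat.mul_pos hLk0 hM1),
      show Sbox * L ^ (j + 1) = cnum * (L ^ (j + 1) * L ^ Mmin) by rw [hSbox_def]; ring]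
  · intro μ
    rw [hsites0, hPL, hSbox_def]
    have hX : 0 < L ^ (j + 1) * L ^ Mmin := Nat.mul_pos hLk0 hM1
    calc L ^ (j + 1) * (L ^ Mmin * cnum) = (L ^ (j + 1) * L ^ Mmin) * cnum := by ring
      _ < (L ^ (j + 1) * L ^ Mmin) * L ^ b := Nat.mul_lt_mul_of_pos_left hcnumb hX
      _ ≤ 2 * (L ^ (j + 1) * L ^ Mmin * L ^ b) := by
          rw [show (L ^ (j + 1) * L ^ Mmin) * L ^ b = L ^ (j + 1) * L ^ Mmin * L ^ b by ring]; omega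
  · intro μ
    rw [hsites0, hPL, hSbox_def]
    calc 2 * (L ^ (j + 1) * (L ^ Mmin * cnum)) = 2 * ((L ^ (j + 1) * L ^ Mmin) * cnum) := by ring
      _ ≤ 2 * ((L ^ (j + 1) * L ^ Mmin) * L ^ b) := Nat.mul_le_mul_left _ (Nat.mul_le_mul_left _ hcnumb')
      _ = 2 * (L ^ (j + 1) * L ^ Mmin * L ^ b) := by ring
  · -- the depth inequality `2r_S + 2·half·(d+1) + 1 ≤ Lᵏm` from `m ≥ 2M(d+2) + 3`
    have hX : rS P (j + 1) (L ^ Mmin) ≤ L ^ (j + 1) * L ^ Mmin + L ^ (j + 1) := by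
      unfold rS
      rw [hhalf, hPL]
      omega
    rw [hhalf, hPd, hPL]
    calc 2 * rS P (j + 1) (L ^ Mmin) + 2 * (L ^ (j + 1) * L ^ Mmin) * (d + 1) + 1
        ≤ 2 * (L ^ (j + 1) * L ^ Mmin + L ^ (j + 1)) + 2 * (L ^ (j + 1) * L ^ Mmin) * (d + 1) + L ^ (j + 1) :=
          Nat.add_le_add (Nat.add_le_add (Nat.mul_le_mul_left 2 hX) le_rfl) hLk1
      _ = L ^ (j + 1) * (2 * L ^ Mmin * (d + 2) + 3) := by ring
      _ ≤ L ^ (j + 1) * m := Nat.mul_le_mul_left _ hm₀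
  -- THE CUT-OFF `ζ^{(k)}` (support radius 3, plateau 0), `R_n = 4`, `n = 2L`
  refine ⟨zeta244 P (j + 1) 3, 3, 0, le_rfl, fun x y' => abs_zeta244_le_one 3 x y', fun x y' h => zeta244_supp hkK h,
    fun x y' h => zeta244_eq_one hkK (by norm_num) h, fun x ν y' => zeta244_lip 3 x ν y', 4, by norm_num, ?_, 2 * L,
    by push_cast; exact hradj, ?_, ?_⟩
  · intro μ
    rw [hsitesk]
    calc 2 * (2 * 4 + 1) = 2 * 9 := by norm_num
      _ ≤ 2 * (L ^ Mmin * L ^ b) := Nat.mul_le_mul_left 2 (le_trans hLb9 (Nat.le_mul_of_pos_left _ hM1))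
  · rw [hPL]; push_cast; nlinarith [hLR]
  -- THE ZERO CHARGE, ZERO FIELD, the (2.55)₂ letter `μ₀` and the charge size `e_c` of §0, THE SCALE `s = Lᵏε`
  obtain ⟨μ₀, hμ₀, htcond, ec, hec0, hece₁, hecs, hccond⟩ := hsmall s hs0 hss₀ hs1
  have hθ₁m' : θ₁ * B2.rFn Q.R Q.r s ≤ (m : ℝ) := by
    rw [← hrk_def]
    have h1 : θ₁ * rk ≤ ⌈θ₁ * rk⌉₊ := Nat.le_ceil _
    have h2 : (⌈θ₁ * rk⌉₊ : ℝ) ≤ m := by exact_mod_cast hmθ₁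
    exact h1.trans h2
  have hθ₂R : θ₂ * B2.rFn Q.R Q.r s ≤ (R₁ : ℝ) + 1 := by
    rw [← hrk_def]
    have h1 : θ₂ * rk ≤ ⌈θ₂ * rk⌉₊ := Nat.le_ceil _
    have h2 : (⌈θ₂ * rk⌉₊ : ℝ) = R₁ := by rw [hR₁_def]
    linarith
  -- THE DICTIONARY HYPOTHESIS `S ≤ θ₃r(s)`: `S ≤ 2m + 1 + M ≤ 2θm·r(s) + M(4d+9) + 9 ≤ 2θm·r(s) + gap·ρ* ≤ θ₃·r(s)`
  have hS3 : (Sbox : ℝ) ≤ θ₃ * B2.rFn Q.R Q.r s := by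
    rw [← hrk_def]
    have h1 : (Sbox : ℝ) ≤ 2 * (m : ℝ) + 1 + (L : ℝ) ^ Mmin := by exact_mod_cast hSbox_le
    have h2 : gap * ρs ≤ gap * rk := mul_le_mul_of_nonneg_left hρsrk hgap.le
    have h3 : θ₃ * rk = 2 * θm * rk + gap * rk := by rw [hgap_def]; ring
    have h4 : 0 ≤ (L : ℝ) := hLR0.le
    have h5 : 2 * (m : ℝ) + 1 + (L : ℝ) ^ Mmin ≤ 2 * θm * rk + Rreq := by
      rw [hRreq_eq]; linarith [hm_real]
    rw [h3]
    linarith [hρsgap, h2, h1, h5]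
  have hmass : msq * P.mesh (j + 1) ^ 2 ≤ m₁ ^ 2 * s ^ 2 := by
    rw [hmeshk]; exact mul_le_mul_of_nonneg_right hm₁ (sq_nonneg _)
  refine ⟨zeroCharge P.d, 0, μ₀, hμ₀, s, hmeshk.symm, hs0, hs1, hθ₁m', hθ₂R, hS3, hmass, ?_, ec, hec0, hece₁, hecs, ?_, ?_⟩
  · rw [hPd, hmeshk]; exact htcond
  · rw [hPd, hmeshk]; exact hccond
  -- THE FINE POINT `x` over the coarse site `(m, …, m)`: margin `m` in `□₂ = [0, M·cnum)ᵈ`, centre of `□₁`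
  have hmk : ∀ ν : Fin P.d, m < P.sitesPerDir (j + 1) ν := by
    intro ν
    rw [hsitesk]
    have : L ^ b ≤ L ^ Mmin * L ^ b := Nat.le_mul_of_pos_left _ hM1
    omega
  have hm0 : ∀ ν : Fin P.d, m * L ^ (j + 1) < P.sitesPerDir 0 ν := by
    intro ν
    rw [hsites0]
    have h1 : L ^ b ≤ L ^ Mmin * L ^ b := Nat.le_mul_of_pos_left _ hM1
    have h2 : m < L ^ Mmin * L ^ b := by omega
    calc m * L ^ (j + 1) < (L ^ Mmin * L ^ b) * L ^ (j + 1) := Nat.mul_lt_mul_of_pos_right h2 hLk0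
      _ ≤ 2 * (L ^ (j + 1) * L ^ Mmin * L ^ b) := by
          rw [show (L ^ Mmin * L ^ b) * L ^ (j + 1) = L ^ (j + 1) * L ^ Mmin * L ^ b by ring]; omega
  let x : HiggsLattice.Site P 0 := fun ν => ((m * L ^ (j + 1) : ℕ) : ZMod (P.sitesPerDir 0 ν))
  have hxval : ∀ ν : Fin P.d, (x ν).val = m * L ^ (j + 1) := fun ν => ZMod.val_natCast_of_lt (hm0 ν)
  have hbx : ∀ ν : Fin P.d, (blockIter (j + 1) x ν).val = m := by
    intro ν
    rw [val_blockIter hkK, hxval, hPL, Nat.mul_div_cancel _ hLk0]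
  have hbx' : ∀ ν : Fin P.d, blockIter (j + 1) x ν = ((m : ℕ) : ZMod (P.sitesPerDir (j + 1) ν)) := by
    intro ν
    rw [← hbx ν, ZMod.natCast_zmod_val]
  refine ⟨x, ?_, ?_, 0, ?_⟩
  · intro ν
    rw [hq0, sub_zero, hbx]
    exact ⟨le_rfl, by omega⟩
  · intro ν
    rw [hbx']
    show (((m : ℕ) : ZMod (P.sitesPerDir (j + 1) ν)) - ((m - R₁ : ℕ) : ZMod (P.sitesPerDir (j + 1) ν))).val = R₁
    rw [← Nat.cast_sub (Nat.sub_le m R₁), Nat.sub_sub_self hR₁m, ZMod.val_natCast_of_lt ((hR₁m.trans_lt (hmk ν)))]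
  · -- (2.55) WITH THE PRINTED THRESHOLDS for the zero fields: the four thresholds are `≥ 0`
    have hℓ0 : 0 < s / (L : ℝ) := div_pos hs0 hLR0
    have hℓ1 : s / (L : ℝ) ≤ 1 := (div_le_self hs0.le hLR.le).trans hs1
    have hpf0 : 0 ≤ B2.pFn Q.b₀ Q.p (s / (L : ℝ)) := B1Ineq353Proof.pFn_nonneg hb0.le hℓ0 hℓ1
    have hlam0 : 0 < B2LargeField.lambdaEps lam (s / (L : ℝ)) P.d := B2LargeField.lambdaEps_pos hlam hℓ0 _
    have hlamq : 0 ≤ 1 / B2LargeField.lambdaEps lam (s / (L : ℝ)) P.d ^ (1 / 4 : ℝ) :=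
      div_nonneg zero_le_one (Real.rpow_nonneg hlam0.le _)
    have htoSite0 : toSite (0 : HiggsLattice.VecField P (j + 1)) = 0 := by
      funext z
      show WithLp.toLp 2 (0 : Fin P.d → ℝ) = 0
      exact WithLp.toLp_zero 2
    refine ⟨fun bnd _ => ?_, fun y _ => ?_, fun bnd _ => ?_, fun y _ => ?_⟩
    · have h0 : dA (0 : HiggsLattice.VecField P (j + 1)) bnd = 0 := by
        unfold dA HiggsLattice.sderiv
        rw [htoSite0]
        simp
      rw [h0]
      exact mul_nonneg hc₁ hpf0
    · have h0 : absA (0 : HiggsLattice.VecField P (j + 1)) y = 0 := by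
        unfold absA
        rw [htoSite0]
        simp
      rw [h0]
      exact mul_nonneg (mul_nonneg hc₁ (by positivity)) hpf0
    · have h0 : dPhi C (j + 1) (ofSite (cutMin (zeroCharge P.d) mu0sq aV (j + 1) (zeta244 P (j + 1) 3)
          (toSite (0 : HiggsLattice.VecField P (j + 1))))) (0 : HiggsLattice.ScalarField P (j + 1) N) bnd = 0 := by
        unfold dPhi HiggsLattice.covDeriv
        simp
      rw [h0]
      exact mul_nonneg hc₁ hpf0
    · have h0 : absPhi (0 : HiggsLattice.ScalarField P (j + 1) N) y = 0 := by
        unfold absPhi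
        simp
      rw [h0]
      exact mul_nonneg (mul_nonneg hc₁ hlamq) hpf0

/-! ## §2 The end statement applied to the witness: its (2.65) bound is inhabited -/

/-- **SHAPE CHECK BY THE KERNEL**: the witness of §1 discharges EVERY hypothesis of own F22
`B2Eq265AsPrinted.eq265_higgs_tower_asPrinted` binder for binder — the theorem applied to it yields its bound
`‖φ^{(k)}(x) − (Q_k^*(A^{(k)})φ)(x)‖ ≤ C·p(Lᵏε)` (print p.572 (2.65) «φ^{(k)}(x) = U(A^{(k)}(Γ^{(k)}_{x,y}))φ(y) + O(p(Lᵏε))») for the witness data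
at every step `j` (for all outer parameters of F22 with `ε₀ > 0`, `c_reg > 0`, `ē > 0`, `m² ≤ m₁²`, `2·max(θ₁, θ₂) < θ₃`): the universally
quantified implication is NOT vacuous. [cite: Balaban1982Higgs2, Lemma 2.4 (2.65) p.572]
[cite: Balaban1982Higgs2, (2.55)–(2.56) p.570, (2.7)–(2.8) p.558, (2.43)–(2.44) p.566, (2.2)/(2.5) p.557] -/
theorem eq265_higgs_tower_asPrinted_inhabited (d L : ℕ) (hd : 1 ≤ d) (hd3 : d ≤ 3) (hL : Odd L ∧ 1 < L) {a : ℝ} (ha : 0 < a)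
    {msq : ℝ} (hmsq : 0 < msq) {aV : ℝ} (haV : 0 < aV) {mu0sq : ℝ} (hmu0 : 0 < mu0sq)
    (N : ℕ) (C : ChargeData N) {ε₀ : ℝ} (hε₀ : 0 < ε₀) {creg : ℝ} (hcreg : 0 < creg)
    (Q : B2.Params) (hQ : Q.Printed) {c₁ lam : ℝ} (hc₁ : 0 ≤ c₁) (hlam : 0 < lam)
    {θ₁ θ₂ θ₃ : ℝ} (hθ₁ : 0 < θ₁) (hθ₂ : 0 < θ₂) (hθ₃ : 2 * max θ₁ θ₂ < θ₃)
    {ebar m₁ : ℝ} (hebar : 0 < ebar) (hm₁ : msq ≤ m₁ ^ 2) :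
    ∃ (M : ℕ) (Cp : ℝ), 0 ≤ Cp ∧ ∀ (j : ℕ),
      ∃ (P : HiggsLattice.Params) (_ : Shape P) (bad : (l : ℕ) → Set (HiggsLattice.Site P l)) (rad : ℕ → ℝ)
        (ζ : HiggsLattice.Site P 0 → HiggsLattice.Site P (j + 1) → ℝ) (C₀ : ChargeData P.d) (A' : HiggsLattice.VecField P (j + 1))
        (x : HiggsLattice.Site P 0) (φ : HiggsLattice.ScalarField P (j + 1) N),
        P.M = M ∧
        ‖bgScalar256 C msq a (j + 1) (prime (towerRegion bad rad j 2)) (prime (towerRegion bad rad j 6))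
              (ofSite (cutMin C₀ mu0sq aV (j + 1) ζ (toSite A'))) φ x
            - avgQkAdj C (ofSite (cutMin C₀ mu0sq aV (j + 1) ζ (toSite A'))) (j + 1) φ x‖
          ≤ Cp * B2.pFn Q.b₀ Q.p (P.mesh (j + 1)) := by
  have hθ₃0 : 0 ≤ θ₃ := by
    have : θ₁ ≤ max θ₁ θ₂ := le_max_left _ _
    linarith
  obtain ⟨δ, CV, CF, -, -, -, Mmin, h⟩ := B2Eq265AsPrinted.eq265_higgs_tower_asPrinted d L hd hd3 hL ha hmsq haV hmu0 N C ε₀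
    creg hcreg.le Q hQ hc₁ hlam hθ₁ hθ₂ (ebar := ebar) (θ₃ := θ₃) (m₁ := m₁) hebar.le hθ₃0
  obtain ⟨M, hM, w⟩ := tower_asPrinted_hypotheses_inhabited d L hd hL aV mu0sq N C hε₀ hcreg Q hQ hc₁ hlam hθ₁ hθ₂ hθ₃
    hebar hm₁ δ CV CF Mmin
  obtain ⟨e₁, t, he₁, ht, Cp, hCp, h⟩ := h M hM
  refine ⟨M, Cp, hCp, fun j => ?_⟩
  obtain ⟨P, S, hPd, hPL, hPM, hjK, h3, hε, h1, bad, rad, -, hrad, sq₂, sq₁, Sfin, q, Sbox, hs2, h16, hbox, hSbox, hsq₂, h2S,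
    q₁, R₁, m, hR₁m, hRm, hsq₁, ζ, ρ, ρ₁, hρ₁, za, zs, zo, zl, Rn, hRn, hRn2, n, hn, hroom, C₀, A', μ₀, hμ₀, s, hs_eq, hs, hs1,
    hθm, hθR, hS3, hmass, ht', ec, hec, hle, hecs, hsmall, x, hmargin, hcentre, φ, h255⟩ := w e₁ t he₁ ht j
  have hmain := h P S hPd hPL hPM hjK h3 hε h1 bad rad hrad sq₂ sq₁ Sfin q Sbox hs2 h16 hbox hSbox hsq₂ h2S q₁ R₁ m hR₁m hRm
    hsq₁ ζ ρ ρ₁ hρ₁ za zs zo zl Rn hRn hRn2 n hn hroom C₀ A' hμ₀ hs hs1 hθm hθR hS3 hmass ht' hec hle hecs hsmall x hmargin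
    hcentre φ h255
  rw [hs_eq] at hmain
  exact ⟨P, S, bad, rad, ζ, C₀, A', x, φ, hPM, hmain⟩

end Literature.MathematicalPhysics.QuantumFieldTheory.Balaban1983to89.B2Eq265AsPrintedWitness

end
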